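import Mathlib
import HarnessLib

/-!
# Eventually-fixed vectors of an additive endomorphism of a `p`-primary group: the AVERAGING LEMMA
# (pure algebra behind GV 2000 Prop. (2.4) READ AT `p = 2` for the local factors of line `bridge`,
# crux `SignedTransportAtTwo`, stmt-BirchSwinnertonDyer-20333, route `ThetaPartnerAtTwo`; lead prover bsd-wall-tp2-p1 g7;
# `--supports`, route-independent, closes nothing)

HONEST FRAMING. THEOREMS ONLY; no definition; BSD is not proved by any of this. For an abelian group `X` all of whose
elements are `p`-power torsion, with FINITE `p^k`-torsion for every `k`, which is `p`-DIVISIBLE, and an injective additive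
endomorphism `Φ` of `X` (in the application: `X = H¹(I_η, E[p^∞])` at a place `η ∤ p` of the cyclotomic tower and `Φ` the
conjugation action of a Frobenius), the set of **eventually `Φ`-fixed** vectors `{x : ∃ n, Φ^{p^n} x = x}` (the vectors
fixed by some `p`-power of `Φ`; for the local factor this is the image of `H¹((K_∞)_η, E[p^∞])`) is again `p`-DIVISIBLE:

* `exists_nsmul_eq_of_iterate_pow_eq` — **averaging lemma**: if `Φ^{p^n} y = y` then `y = p • x` for some `x` with
  `Φ^{p^m} x = x` for some `m` (choose `x₀` with `p x₀ = y`; on the finite `Φ`-stable set `X[p^k] ∋ x₀` a suitable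
  `p`-power `Ψ = Φ^{p^m}` has order `d` prime to `p` and fixes `y`; then `x = d⁻¹ Σ_{i<d} Ψ^i x₀` works, `d⁻¹` taken
  modulo `p^k`);
* `iterate_pow_eq_of_le` — `Φ^{p^n} x = x → Φ^{p^m} x = x` for `n ≤ m`; closure lemmas (`add`, `neg`, `nsmul`, `zero`)
  making `{x : ∃ n, Φ^{p^n} x = x}` an additive subgroup in all but name.

References: [GreenbergVatsal2000] §2 Prop. (2.4) p. 22 ("`𝓗_ℓ(ℚ_∞) ≅ (ℚ_p/ℤ_p)^{s_ℓ d_ℓ}`", divisibility of the local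
factor); [SerreLocalFields1979] XIII §1 (cohomology of procyclic groups); folklore (averaging over a group of order
prime to `p`).
-/

set_option autoImplicit false
-- D-0017: single-problem summit, so `Summit.BirchSwinnertonDyer.BirchSwinnertonDyer.…` repeats a namespace BY DESIGN.
set_option linter.dupNamespace false

namespace Summit.BirchSwinnertonDyer.BirchSwinnertonDyer.Theorems.SignedTransportAtTwo

open Function

variable {X : Type*} [AddCommGroup X]

/-! ## §1. Iterates of an additive endomorphism -/

/-- `Φ^{p^n} x = x` implies `Φ^{p^m} x = x` for `n ≤ m` (`p^m = p^n · p^{m-n}`). [folklore] -/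
theorem iterate_pow_eq_of_le (Φ : X →+ X) {p : ℕ} {x : X} {n m : ℕ} (hnm : n ≤ m)
    (h : (⇑Φ)^[p ^ n] x = x) : (⇑Φ)^[p ^ m] x = x := by
  obtain ⟨d, rfl⟩ := Nat.exists_eq_add_of_le hnm
  rw [pow_add, Function.iterate_mul]
  exact Function.iterate_fixed h _

/-- Eventually fixed vectors are stable under addition. [folklore] -/
theorem exists_iterate_pow_eq_add (Φ : X →+ X) {p : ℕ} {x y : X}
    (hx : ∃ n : ℕ, (⇑Φ)^[p ^ n] x = x) (hy : ∃ n : ℕ, (⇑Φ)^[p ^ n] y = y) :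
    ∃ n : ℕ, (⇑Φ)^[p ^ n] (x + y) = x + y := by
  obtain ⟨n, hn⟩ := hx
  obtain ⟨m, hm⟩ := hy
  refine ⟨max n m, ?_⟩
  rw [iterate_map_add, iterate_pow_eq_of_le Φ (le_max_left n m) hn, iterate_pow_eq_of_le Φ (le_max_right n m) hm]

/-- Eventually fixed vectors are stable under negation. [folklore] -/
theorem exists_iterate_pow_eq_neg (Φ : X →+ X) {p : ℕ} {x : X}
    (hx : ∃ n : ℕ, (⇑Φ)^[p ^ n] x = x) : ∃ n : ℕ, (⇑Φ)^[p ^ n] (-x) = -x := by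
  obtain ⟨n, hn⟩ := hx
  exact ⟨n, by rw [iterate_map_neg, hn]⟩

/-- `0` is fixed by every iterate. [folklore] -/
theorem iterate_pow_zero (Φ : X →+ X) (p n : ℕ) : (⇑Φ)^[p ^ n] (0 : X) = 0 :=
  iterate_map_zero Φ _

/-- Eventually fixed vectors are stable under `ℕ`-multiples. [folklore] -/
theorem exists_iterate_pow_eq_nsmul (Φ : X →+ X) {p : ℕ} {x : X} (c : ℕ)
    (hx : ∃ n : ℕ, (⇑Φ)^[p ^ n] x = x) : ∃ n : ℕ, (⇑Φ)^[p ^ n] (c • x) = c • x := by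
  obtain ⟨n, hn⟩ := hx
  exact ⟨n, by rw [iterate_map_nsmul, hn]⟩

/-! ## §2. The averaging lemma -/

/-- An injective additive endomorphism restricts to a PERMUTATION of every finite torsion level `X[q] = {x : q • x = 0}`.
[folklore] -/
theorem bijOn_of_injective (Φ : X →+ X) (hΦ : Injective Φ) (q : ℕ) (hfin : Set.Finite {x : X | q • x = 0}) :
    Set.BijOn Φ {x : X | q • x = 0} {x : X | q • x = 0} := by
  have hmaps : Set.MapsTo Φ {x : X | q • x = 0} {x : X | q • x = 0} := by
    intro x hx
    simp only [Set.mem_setOf_eq] at hx ⊢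
    rw [← map_nsmul, hx, map_zero]
  exact (hfin.injOn_iff_bijOn_of_mapsTo hmaps).mp hΦ.injOn

/-- Shifting by `g` permutes the first `d` iterates of `x` under `g` when `g^[d] x = x`. [folklore] -/
theorem apply_sum_range_iterate_eq {Y : Type*} [AddCommMonoid Y] (g : Y →+ Y) (x : Y) (d : ℕ)
    (hd : (⇑g)^[d] x = x) :
    g (∑ i ∈ Finset.range d, (⇑g)^[i] x) = ∑ i ∈ Finset.range d, (⇑g)^[i] x := by
  rw [map_sum]
  have e : ∀ i, g ((⇑g)^[i] x) = (⇑g)^[i + 1] x := fun i ↦ by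
    rw [Function.iterate_succ_apply']
  simp_rw [e]
  rcases d with _ | d
  · simp
  · rw [Finset.sum_range_succ, Finset.sum_range_succ' (fun i ↦ (⇑g)^[i] x), hd,
      Function.iterate_zero_apply]

/-- **Averaging lemma.** `X` an abelian group whose elements are `p`-power torsion (`htor`), with finite `p^k`-torsion
(`hfin`) and `p`-divisible (`hdiv`); `Φ` an injective additive endomorphism. If `y` is fixed by `Φ^{p^n}` then
`y = p • x` for some `x` fixed by some `Φ^{p^m}`. (On the finite `Φ`-stable set `X[p^k]` containing a `p`-th root `x₀`
of `y`, some `p`-power `Ψ = Φ^{p^{n+e}}` has order `d` prime to `p`; average `x₀` over `⟨Ψ⟩` and divide by `d` modulo `p^k`.)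
[cite: GreenbergVatsal2000, §2 Prop. (2.4) (p. 22)] -/
theorem exists_nsmul_eq_of_iterate_pow_eq {p : ℕ} [hp : Fact p.Prime] (Φ : X →+ X) (hΦ : Injective Φ)
    (htor : ∀ x : X, ∃ k : ℕ, p ^ k • x = 0) (hfin : ∀ k : ℕ, Set.Finite {x : X | p ^ k • x = 0})
    (hdiv : ∀ y : X, ∃ x : X, p • x = y) {y : X} {n : ℕ} (hy : (⇑Φ)^[p ^ n] y = y) :
    ∃ x : X, p • x = y ∧ ∃ m : ℕ, (⇑Φ)^[p ^ m] x = x := by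
  classical
  obtain ⟨x₀, hx₀⟩ := hdiv y
  obtain ⟨k, hk⟩ := htor x₀
  -- the finite `Φ`-stable torsion level `T = X[p^k] ∋ x₀, y`
  set T : Set X := {x : X | p ^ k • x = 0} with hT
  have hTfin : T.Finite := hfin k
  have hx₀T : x₀ ∈ T := hk
  have hyT : y ∈ T := by
    show p ^ k • y = 0
    rw [← hx₀, smul_smul, mul_comm, ← smul_smul, hk, smul_zero]
  -- `Φ` as a permutation `σ` of the finite type `T`
  haveI : Finite T := hTfin.to_subtype
  have hbij := bijOn_of_injective Φ hΦ (p ^ k) hTfin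
  let σ : Equiv.Perm T := hbij.equiv Φ
  have hσ1 : ∀ t : T, ((σ t : T) : X) = Φ t := fun _ ↦ rfl
  have hσ : ∀ (j : ℕ) (t : T), ((σ ^ j) t : X) = (⇑Φ)^[j] t := by
    intro j
    induction j with
    | zero => intro t; rfl
    | succ j ih =>
      intro t
      rw [pow_succ', Equiv.Perm.mul_apply, Function.iterate_succ_apply', hσ1, ih]
  -- the order of `σ^{p^n}` is `p^e · d` with `p ∤ d`; `Ψ = σ^{p^{n+e}}` satisfies `Ψ^d = 1`
  obtain ⟨e, d, hd, hN⟩ := Nat.exists_eq_pow_mul_and_not_dvd (orderOf_pos (σ ^ p ^ n)).ne' p hp.out.ne_one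
  set Ψ : Equiv.Perm T := σ ^ p ^ (n + e) with hΨ
  have hΨd : Ψ ^ d = 1 := by
    rw [hΨ, pow_add, pow_mul, ← pow_mul, ← hN]
    exact pow_orderOf_eq_one _
  -- the additive endomorphism `g = Φ^{p^{n+e}}`
  let g : X →+ X :=
    { toFun := (⇑Φ)^[p ^ (n + e)]
      map_zero' := iterate_map_zero Φ _
      map_add' := iterate_map_add Φ _ }
  have hgcoe : (⇑g) = (⇑Φ)^[p ^ (n + e)] := rfl
  have hΨiter : ∀ (i : ℕ) (t : T), ((Ψ ^ i) t : X) = (⇑g)^[i] t := by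
    intro i t
    rw [hΨ, ← pow_mul, hσ, hgcoe, ← Function.iterate_mul, mul_comm]
  -- `g` fixes `y`
  have hgy1 : g y = y := by
    show (⇑Φ)^[p ^ (n + e)] y = y
    exact iterate_pow_eq_of_le Φ (Nat.le_add_right n e) hy
  have hgy : ∀ i : ℕ, (⇑g)^[i] y = y := fun i ↦ Function.iterate_fixed hgy1 i
  -- the average `s = Σ_{i<d} g^i x₀` is `g`-fixed and `p • s = d • y`
  set s : X := ∑ i ∈ Finset.range d, (⇑g)^[i] x₀ with hs
  have hgd : (⇑g)^[d] x₀ = x₀ := by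
    have := hΨiter d ⟨x₀, hx₀T⟩
    rw [hΨd, Equiv.Perm.one_apply] at this
    exact this.symm
  have hgs : g s = s := apply_sum_range_iterate_eq g x₀ d hgd
  have hps : p • s = d • y := by
    rw [hs, Finset.smul_sum]
    have e1 : ∀ i ∈ Finset.range d, p • (⇑g)^[i] x₀ = y := by
      intro i _
      rw [← iterate_map_nsmul, hx₀, hgy]
    rw [Finset.sum_congr rfl e1, Finset.sum_const, Finset.card_range]
  -- divide by `d` modulo `p^k` (`p ∤ d`)
  have hcop : Nat.Coprime d (p ^ k) :=
    Nat.Coprime.pow_right k ((Nat.Prime.coprime_iff_not_dvd hp.out).2 hd).symm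
  have hyk : p ^ k • y = 0 := hyT
  rcases Nat.lt_or_ge 1 (p ^ k) with h1 | h1
  · obtain ⟨u, -, hu⟩ := Nat.exists_mul_mod_eq_one_of_coprime hcop h1
    refine ⟨u • s, ?_, n + e, ?_⟩
    · -- `p • (u • s) = (u d) • y = y`
      rw [smul_comm, hps, smul_smul, mul_comm u d]
      obtain ⟨q, hq⟩ : ∃ q : ℕ, d * u = p ^ k * q + 1 :=
        ⟨d * u / p ^ k, by have := Nat.div_add_mod (d * u) (p ^ k); rw [hu] at this; exact this.symm⟩
      rw [hq, add_smul, mul_comm, ← smul_smul, hyk, smul_zero, zero_add, one_smul]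
    · rw [iterate_map_nsmul, ← hgcoe, hgs]
  · -- degenerate level `p^k = 1`: then `y = 0`
    have hpk : p ^ k = 1 := le_antisymm h1 (Nat.one_le_pow _ _ hp.out.pos)
    rw [hpk, one_smul] at hyk
    refine ⟨0, ?_, 0, ?_⟩
    · rw [smul_zero, hyk]
    · exact iterate_pow_zero Φ p 0

end Summit.BirchSwinnertonDyer.BirchSwinnertonDyer.Theorems.SignedTransportAtTwo
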